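import Literature.AlgebraicGeometry.Motives.StandardConjectures
import Literature.AlgebraicGeometry.Motives.CorrespondencesCompProofs
import Literature.AlgebraicGeometry.Motives.VarietiesProjectiveSpaceProofs
import HarnessLib

/-!
# Discharged fact: the standard conjecture of Lefschetz type implies the Künneth conjecture

`Literature.AlgebraicGeometry.Motives.StandardConjectures` records as a named fact (hodge.S29)
`Literature.AlgebraicGeometry.Motives.standardConjectureC_of_standardConjectureB : Prop` — for a
Weil cohomology theory `W`, a smooth projective `X` of dimension `n` and a hyperplane class `η`,
the `θ`-form of Grothendieck's standard conjecture of Lefschetz type `B(X)` (for every `i ≤ n`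
the inverse `θⁱ` of `Lⁿ⁻ⁱ : Hⁱ(X) ⥲ H²ⁿ⁻ⁱ(X)` is induced by an algebraic correspondence with
`ℚ`-coefficients) implies the standard conjecture of Künneth type `C(X)` (the Künneth projectors
`πⁱ` are algebraic). This file **proves** it (`standardConjectureC_of_standardConjectureB_holds`).

Sources: S. Kleiman, *Algebraic cycles and the Weil conjectures*, in: Dix exposés sur la
cohomologie des schémas (1968), §1.4 (formulas 1.4.2–1.4.6: the `πⁱ`, `θⁱ`, `Λ`, `⋆` are
universal non-commutative polynomials in `L` and any one of the others) and §2 (the forms of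
`B(X)`; `B(X) ⇒ C(X)`); S. Kleiman, *The standard conjectures*, in: Motives (Seattle 1991),
Proc. Sympos. Pure Math. 55 (1) (1994), §4, Thm. 4-1 and the remarks following it; restated as
`B(X) ⇒ C(X)` with reference `[Kl, 4.1]` in B. Kahn, J. Murre, C. Pedrini, *On the transcendental
part of the motive of a surface*, in: Algebraic cycles and motives, Vol. 2, LMS Lecture Note
Ser. 344 (2007), §7.7, (7.10), and in J. Murre, *Algebraic cycles and algebraic aspects of
cohomology and K-theory* (Torino 1993), Lecture Notes in Math. 1594 (1994), 7.7 ("(LStC) implies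
that the Künneth components are algebraic (Kleiman 1994, section 4)").

## The argument (formal in the axioms of `WeilCohomology`; no hard Lefschetz hypothesis)

In the `θ`-form the polynomial of Kleiman 1968 §1.4 is the shortest possible one:
`πⁱ = θⁱ ∘ Lⁿ⁻ⁱ` for `i ≤ n` and `π²ⁿ⁻ⁱ = Lⁿ⁻ⁱ ∘ θⁱ` for `i ≤ n`, as *graded* operators.

1. The iterated Lefschetz operator `Lʳ = (· ∪ ηʳ)` as a graded operator `H•(X) → H•(X)` (all
   bidegrees `(a, a + 2r)`; written as a graded operator `T` characterised by its components, no
   new definition). Composing it on either side with a graded operator concentrated in one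
   bidegree `(a, b)` (`GradedOp.ofLinearMap θ`) gives the graded operator concentrated in one
   bidegree with component `θ ∘ Lʳ`, resp. `Lʳ ∘ θ` (`ofLinearMap_comp_of_lefschetzPow`,
   `comp_ofLinearMap_of_lefschetzPow`).
2. `exists_isAlgebraicGradedOp_lefschetzPow` (Kleiman 1968 §1.4, "`L` is algebraic"): `Lʳ` is induced
   by the rational algebraic class `pr₁* ηʳ ∪ Δ ∈ Aⁿ⁺ʳ(X × X)_ℚ`, where `Δ ∈ Aⁿ(X × X)_ℚ`
   induces the identity (axiom `exists_isInducedBy_id`): in Kleiman's pairing form,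
   `tr_X ((x ∪ ηʳ) ∪ y) = tr_{X×X} ((pr₁* (x ∪ ηʳ) ∪ Δ) ∪ pr₂* y)` and
   `pr₁* (x ∪ ηʳ) ∪ Δ = pr₁* x ∪ (pr₁* ηʳ ∪ Δ)` (`map_cup`, `cup_assoc`). The class `ηʳ` is
   rational algebraic: `η = ι* cl(D)` is the pull-back of the class of a codimension-`1` cycle on
   `ℙᴺ` (`pullback_ratAlgebraicClasses_le`, `isSmoothProjective_projectiveSpace_holds`,
   `cycleMap_mem_algebraicLattice`), `1 = cl(X)` is the class of the generic point
   (`cycleClass_of_coheight_eq_zero`), and cup products of rational algebraic classes are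
   rational algebraic (`cup_mem_ratAlgebraicClasses`).
3. `standardConjectureC_of_standardConjectureB_holds`: for `i ≤ n`, `B(X, η)` provides an
   algebraic `θ : H²ⁿ⁻ⁱ(X) → Hⁱ(X)` with `θ ∘ Lⁿ⁻ⁱ = id`, so `πⁱ = ofLinearMap θ ∘ Lⁿ⁻ⁱ` is
   algebraic by the discharged fact `isAlgebraicGradedOp_comp_holds` (composites of algebraic
   correspondences are algebraic); for `n ≤ i ≤ 2n`, `πⁱ = Lⁱ⁻ⁿ ∘ ofLinearMap θ²ⁿ⁻ⁱ` likewise,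
   using `Lⁱ⁻ⁿ ∘ θ = id`; for `i > 2n`, `Hⁱ(X) = 0` (`subsingleton_obj`) and `πⁱ = 0` is induced
   by the zero classes.

No statement of `StandardConjectures.lean` or `Correspondences.lean` is restated or modified; no
definition and no new named fact is introduced (theorems only).

## References

* S. Kleiman, *Algebraic cycles and the Weil conjectures*, in: Dix exposés sur la cohomologie
  des schémas, North-Holland (1968), 359–386, §1.4 and §2. [Kleiman1968AlgebraicCycles]
* S. Kleiman, *The standard conjectures*, in: Motives (Seattle, WA, 1991), Proc. Sympos. Pure
  Math. 55, Part 1, AMS (1994), 3–20, §4, Thm. 4-1. [Kleiman1994]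
* B. Kahn, J. P. Murre, C. Pedrini, *On the transcendental part of the motive of a surface*, in:
  Algebraic cycles and motives, Vol. 2, LMS Lecture Note Ser. 344, CUP (2007), 143–202, §7.7,
  (7.10).
* J. P. Murre, *Algebraic cycles and algebraic aspects of cohomology and K-theory*, in: Algebraic
  cycles and Hodge theory (Torino 1993), Lecture Notes in Math. 1594, Springer (1994), 7.7.
-/

universe u v

open CategoryTheory AlgebraicGeometry MonoidalCategory CartesianMonoidalCategory Opposite
open scoped TensorProduct DirectSum

noncomputable section

namespace Literature.AlgebraicGeometry.Motives

/-! ## Composites with the iterated Lefschetz operator as a graded operator -/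

namespace PreWeilCohomology

variable {k : Type u} [Field k] {K : Type v} [Field K] (W : PreWeilCohomology k K)
variable {X Y : SchemeOver k}

namespace GradedOp

variable {W}

/-- Composite of the graded operator `Lʳ = (· ∪ ηʳ)` (a graded operator `T` whose component
`Hᵃ(X) → Hᵇ(X)` is `Lʳ` if `a + 2r = b` and `0` otherwise; Kleiman 1968 §1.4) followed by a
graded operator concentrated in the single bidegree `(a, b)` with `i + 2r = a`: the graded
operator concentrated in bidegree `(i, b)` with component `θ ∘ Lʳ` (a one-term sum over the
middle degree). [folklore] -/
lemma ofLinearMap_comp_of_lefschetzPow (η : W.obj X 2) (r : ℕ) {T : W.GradedOp X X}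
    (hT : ∀ ⦃a b : ℕ⦄ (h : a + 2 * r = b), T a b = W.lefschetzPow X η r a b h)
    (hT₀ : ∀ ⦃a b : ℕ⦄, ¬ a + 2 * r = b → T a b = 0) {i a b : ℕ}
    (θ : W.obj X a →ₗ[K] W.obj X b) (h : i + 2 * r = a) :
    (ofLinearMap θ).comp T = ofLinearMap (θ ∘ₗ W.lefschetzPow X η r i a h) := by
  funext i' j
  have hsingle : (ofLinearMap θ).comp T i' j = (ofLinearMap θ a j).comp (T i' a) := by
    refine finsum_eq_single _ a fun m hm ↦ ?_
    rw [ofLinearMap_apply_of_ne θ (fun hh ↦ hm hh.1.symm), LinearMap.zero_comp]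
  rw [hsingle]
  by_cases hj : b = j
  · subst hj
    rw [ofLinearMap_apply_same]
    by_cases hi : i' + 2 * r = a
    · obtain rfl : i' = i := by omega
      rw [hT hi, ofLinearMap_apply_same]
    · rw [hT₀ hi, LinearMap.comp_zero, ofLinearMap_apply_of_ne]
      rintro ⟨rfl, -⟩
      exact hi h
  · rw [ofLinearMap_apply_of_ne θ (fun hh ↦ hj hh.2), LinearMap.zero_comp,
      ofLinearMap_apply_of_ne]
    exact fun hh ↦ hj hh.2

/-- Composite of a graded operator concentrated in the single bidegree `(a, b)` followed by the
graded operator `Lʳ` (a graded operator `T` as in `ofLinearMap_comp_of_lefschetzPow`): the graded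
operator concentrated in bidegree `(a, b + 2r)` with component `Lʳ ∘ θ`. [folklore] -/
lemma comp_ofLinearMap_of_lefschetzPow (η : W.obj X 2) (r : ℕ) {T : W.GradedOp X X}
    (hT : ∀ ⦃a b : ℕ⦄ (h : a + 2 * r = b), T a b = W.lefschetzPow X η r a b h)
    (hT₀ : ∀ ⦃a b : ℕ⦄, ¬ a + 2 * r = b → T a b = 0) {a b c : ℕ}
    (θ : W.obj X a →ₗ[K] W.obj X b) (h : b + 2 * r = c) :
    T.comp (ofLinearMap θ) = ofLinearMap (W.lefschetzPow X η r b c h ∘ₗ θ) := by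
  funext i j
  have hsingle : T.comp (ofLinearMap θ) i j = (T b j).comp (ofLinearMap θ i b) := by
    refine finsum_eq_single _ b fun m hm ↦ ?_
    rw [ofLinearMap_apply_of_ne θ (fun hh ↦ hm hh.2.symm), LinearMap.comp_zero]
  rw [hsingle]
  by_cases hi : a = i
  · subst hi
    rw [ofLinearMap_apply_same]
    by_cases hj : b + 2 * r = j
    · obtain rfl : j = c := by omega
      rw [hT hj, ofLinearMap_apply_same]
    · rw [hT₀ hj, LinearMap.zero_comp, ofLinearMap_apply_of_ne]
      rintro ⟨-, rfl⟩
      exact hj h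
  · rw [ofLinearMap_apply_of_ne θ (fun hh ↦ hi hh.1), LinearMap.comp_zero,
      ofLinearMap_apply_of_ne]
    exact fun hh ↦ hi hh.1

/-- A graded operator concentrated in one bidegree whose source `Hⁱ(X)` is zero is the zero
graded operator. [folklore] -/
lemma ofLinearMap_eq_zero_of_subsingleton {i j : ℕ} [Subsingleton (W.obj X i)]
    (T : W.obj X i →ₗ[K] W.obj Y j) : ofLinearMap T = 0 := by
  funext a b
  by_cases h : i = a ∧ j = b
  · obtain ⟨rfl, rfl⟩ := h
    rw [ofLinearMap_apply_same]
    ext x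
    rw [Subsingleton.elim x 0, map_zero, map_zero]
  · rw [ofLinearMap_apply_of_ne _ h]
    rfl

end GradedOp

end PreWeilCohomology

namespace WeilCohomology

variable {k : Type u} [Field k] {K : Type v} [Field K] [CharZero K] (W : WeilCohomology k K)
variable {n : ℕ} {X Y : SchemeOver k}

/-! ## Algebraicity of hyperplane classes and their powers -/

/-- A hyperplane class is a rational algebraic class, `η = ι* cl(D) ∈ A¹(X)_ℚ`: the class of the
codimension-`1` cycle `D` on `ℙᴺ` is algebraic (`cycleMap_mem_algebraicLattice`), `ℙᴺ` is smooth
projective (`isSmoothProjective_projectiveSpace_holds`) and pull-backs preserve rational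
algebraic classes (axiom `pullback_ratAlgebraicClasses_le`) (Kleiman 1968 §1.4, "`L` is
algebraic"). Private copy of `WeilCohomology.mem_ratAlgebraicClasses_of_isHyperplaneClass`
(`MotivatedCyclesProofs`), kept local to avoid that import. [cite: Kleiman1968AlgebraicCycles, §1.4] -/
private theorem isHyperplaneClass.mem_ratAlgebraicClasses (hX : IsSmoothProjective n X)
    {η : W.obj X 2} (hη : W.IsHyperplaneClass X η) : η ∈ W.ratAlgebraicClasses X 1 := by
  obtain ⟨e, D, hD, -, rfl⟩ := hη
  exact W.pullback_ratAlgebraicClasses_le hX (isSmoothProjective_projectiveSpace_holds k e.n) e.ι 1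
    ⟨_, W.algebraicLattice_le_ratAlgebraicClasses _ 1 (W.cycleMap_mem_algebraicLattice _ 1 hD),
      rfl⟩

/-- The unit `1 ∈ H⁰(X)` is a rational algebraic class on a smooth projective `X`: it is the
class of the codimension-`0` prime cycle `X`, i.e. of the generic point (axiom
`cycleClass_of_coheight_eq_zero`; Kleiman 1968 §1.2 (C), `γ_X(1_X) = 1`). [cite: Kleiman1968AlgebraicCycles, §1.2 (C)] -/
theorem one_mem_ratAlgebraicClasses (hX : IsSmoothProjective n X) :
    W.one X ∈ W.ratAlgebraicClasses X 0 := by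
  haveI : IrreducibleSpace X.left :=
    haveI := hX.geometricallyIrreducible
    GeometricallyIrreducible.irreducibleSpace_of_subsingleton X.hom
  have h0 : Order.coheight (genericPoint X.left) = 0 := by
    rw [Order.coheight_eq_zero]
    intro b _
    exact Scheme.le_iff_specializes.2 ((genericPoint_spec X.left).specializes (Set.mem_univ b))
  rw [← W.cycleClass_of_coheight_eq_zero hX _ h0]
  exact W.algebraicLattice_le_ratAlgebraicClasses X 0 (W.cycleClass_mem_algebraicLattice X 0 h0)

/-- Powers of a rational algebraic class `η ∈ A¹(X)_ℚ` are rational algebraic, `ηʳ ∈ Aʳ(X)_ℚ`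
(axiom `cup_mem_ratAlgebraicClasses`). [folklore] -/
theorem pow_mem_ratAlgebraicClasses (hX : IsSmoothProjective n X) {η : W.obj X 2}
    (hη : η ∈ W.ratAlgebraicClasses X 1) (r : ℕ) : W.pow X η r ∈ W.ratAlgebraicClasses X r := by
  induction r with
  | zero => exact W.one_mem_ratAlgebraicClasses hX
  | succ r ih => exact W.cup_mem_ratAlgebraicClasses hX rfl _ _ ih hη

/-! ## The correspondence inducing `Lʳ` -/

/-- Transport of a degree identity through an iterated cup product: the two ways of typing
`(a ∪ b) ∪ c` along propositionally equal middle degrees agree. [folklore] -/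
lemma cup_cup_congr {V : SchemeOver k} {a b m m' l N : ℕ} (h₁ : a + b = m) (h₁' : a + b = m')
    (h₂ : m + l = N) (h₂' : m' + l = N) (x : W.obj V a) (y : W.obj V b) (z : W.obj V l) :
    W.cup h₂ (W.cup h₁ x y) z = W.cup h₂' (W.cup h₁' x y) z := by
  subst h₁
  subst h₁'
  rfl

/-- **`Lʳ` is induced by `pr₁* ηʳ ∪ Δ`** (Kleiman 1968 §1.4): if `Δ` induces the identity of every
`Hʲ(X)`, then for `i + 2r = j` the operator `Lʳ : Hⁱ(X) → Hʲ(X)` is induced by `pr₁* ηʳ ∪ Δ`: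
`tr_X ((x ∪ ηʳ) ∪ y) = tr_{X×X} ((pr₁* (x ∪ ηʳ) ∪ Δ) ∪ pr₂* y)` and
`pr₁* (x ∪ ηʳ) ∪ Δ = pr₁* x ∪ (pr₁* ηʳ ∪ Δ)` (`map_cup`, `cup_assoc`).
[cite: Kleiman1968AlgebraicCycles, §1.4] -/
theorem isInducedBy_lefschetzPow (hX : IsSmoothProjective n X) (η : W.obj X 2) (r : ℕ)
    {Δ : W.obj (X ⊗ X) (2 * n)}
    (hΔ : ∀ (i j' : ℕ) (hj : i + j' = 2 * n),
      W.IsInducedBy n n Δ (LinearMap.id : W.obj X i →ₗ[K] W.obj X i) hj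
        (show i + 2 * n + j' = 2 * (n + n) by omega))
    {i j j' c : ℕ} (h : i + 2 * r = j) (hc : 2 * r + 2 * n = 2 * c) (hj : j + j' = 2 * n)
    (hm : i + 2 * c + j' = 2 * (n + n)) :
    W.IsInducedBy n n (W.cup hc (W.pullback (fst X X) (2 * r) (W.pow X η r)) Δ)
      (W.lefschetzPow X η r i j h) hj hm := by
  have hXX := IsSmoothProjective.tensor_holds hX hX
  intro x y
  have hid := hΔ j j' hj (W.lefschetzPow X η r i j h x) y
  rw [LinearMap.id_apply] at hid
  rw [hid]
  change W.trace (X ⊗ X) (n + n) (W.cup _ (W.cup rfl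
      (W.pullback (fst X X) j (W.cup h x (W.pow X η r))) Δ) (W.pullback (snd X X) j' y)) = _
  rw [W.map_cup hXX hX (fst X X) h x (W.pow X η r),
    W.cup_assoc hXX h hc rfl (show i + 2 * c = j + 2 * n by omega),
    W.cup_cup_congr (show i + 2 * c = j + 2 * n by omega) rfl _ hm]

/-- The zero graded operator is algebraic (induced by the zero classes). [folklore] -/
theorem isAlgebraicGradedOp_zero (nX nY : ℕ) : W.IsAlgebraicGradedOp nX nY (0 : W.GradedOp X Y) := by
  refine ⟨fun _ ↦ 0, ?_, fun _ _ _ ↦ rfl⟩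
  intro i j c j' hj hm _ x y
  simp

/-- **The iterated Lefschetz operator is algebraic** (Kleiman 1968 §1.4: `L`, being induced by
the algebraic cycle `Δ₊ ηʳ`, is an algebraic correspondence): for `X` smooth projective of
dimension `n` and `η ∈ A¹(X)_ℚ`, the graded operator `Lʳ = (· ∪ ηʳ)` (component `Hᵃ(X) → Hᵇ(X)`
equal to `Lʳ` if `a + 2r = b` and `0` otherwise) is induced by the rational algebraic classes
`pr₁* ηʳ ∪ Δ` in degree `2(n + r)` and `0` in the other degrees, where `Δ ∈ Aⁿ(X × X)_ℚ` induces
the identity (axiom `exists_isInducedBy_id`).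

Depends only on: `exists_isInducedBy_id`, `IsSmoothProjective.tensor_holds`, `map_cup`,
`cup_assoc`, `pullback_ratAlgebraicClasses_le`, `cup_mem_ratAlgebraicClasses`,
`cycleClass_of_coheight_eq_zero` (for `η⁰ = 1`). [cite: Kleiman1968AlgebraicCycles, §1.4] -/
theorem exists_isAlgebraicGradedOp_lefschetzPow (hX : IsSmoothProjective n X) {η : W.obj X 2}
    (hη : η ∈ W.ratAlgebraicClasses X 1) (r : ℕ) :
    ∃ T : W.GradedOp X X, (∀ ⦃a b : ℕ⦄ (h : a + 2 * r = b), T a b = W.lefschetzPow X η r a b h) ∧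
      (∀ ⦃a b : ℕ⦄, ¬ a + 2 * r = b → T a b = 0) ∧ W.IsAlgebraicGradedOp n n T := by
  have hXX := IsSmoothProjective.tensor_holds hX hX
  obtain ⟨Δ, hΔmem, hΔ⟩ := W.exists_isInducedBy_id hX
  refine ⟨fun a b ↦ if h : a + 2 * r = b then W.lefschetzPow X η r a b h else 0,
    fun a b h ↦ dif_pos h, fun a b h ↦ dif_neg h, ?_⟩
  -- the classes `pr₁* ηʳ ∪ Δ` (degree `2(r + n)`) and `0` (other degrees) are rational algebraic
  have hmem : ∀ c : ℕ, (if h : 2 * r + 2 * n = 2 * c then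
      W.cup h (W.pullback (fst X X) (2 * r) (W.pow X η r)) Δ else 0) ∈
        W.ratAlgebraicClasses (X ⊗ X) c := by
    intro c
    split_ifs with h
    · exact W.cup_mem_ratAlgebraicClasses hXX (show r + n = c by omega) _ _
        (W.pullback_ratAlgebraicClasses_le hXX hX (fst X X) r
          ⟨_, W.pow_mem_ratAlgebraicClasses hX hη r, rfl⟩) hΔmem
    · exact zero_mem _
  refine ⟨fun c ↦ ⟨_, hmem c⟩, ?_, ?_⟩
  · intro i j c j' hj hm hc
    dsimp only
    by_cases h : i + 2 * r = j
    · have hc' : 2 * r + 2 * n = 2 * c := by omega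
      rw [dif_pos h, dif_pos hc']
      exact W.isInducedBy_lefschetzPow hX η r hΔ h hc' hj hm
    · have hc' : ¬ 2 * r + 2 * n = 2 * c := by omega
      rw [dif_neg h, dif_neg hc']
      intro x y
      simp
  · intro i j hne
    exact dif_neg fun h ↦ hne ⟨n + r, by omega⟩

end WeilCohomology

/-! ## `B(X) ⇒ C(X)` -/

section Discharge

variable {k : Type u} [Field k] {K : Type v} [Field K] [CharZero K]
variable {W : WeilCohomology k K} {n : ℕ} {X : SchemeOver k} {η : W.obj X 2}

/-- **`B(X) ⇒ C(X)`**: discharge of the named fact `standardConjectureC_of_standardConjectureB`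
(hodge.S29). For `X` smooth projective of dimension `n` with hyperplane class `η`, the `θ`-form
of the standard conjecture of Lefschetz type implies the standard conjecture of Künneth type
(Kleiman 1968 §1.4 and §2: the `πⁱ` are universal polynomials in `L` and the `θⁱ`; Kleiman 1994
§4, Thm. 4-1 ff.; Kahn–Murre–Pedrini 2007, (7.10) `B(X) ⇒ C(X)`).

Proof: by `WeilCohomology.standardConjectureC_iff` it suffices that each `id : Hⁱ(X) → Hⁱ(X)`,
as a graded operator concentrated in bidegree `(i, i)`, is algebraic. For `i ≤ n`, `B(X, η)`
gives an algebraic `θ : H²ⁿ⁻ⁱ(X) → Hⁱ(X)` with `θ ∘ Lⁿ⁻ⁱ = id`, and the composite of the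
algebraic graded operators `Lⁿ⁻ⁱ` (`exists_isAlgebraicGradedOp_lefschetzPow`) and `θ` is
`ofLinearMap (θ ∘ Lⁿ⁻ⁱ) = ofLinearMap id` (`ofLinearMap_comp_of_lefschetzPow`), algebraic by
`isAlgebraicGradedOp_comp_holds`; for `n ≤ i ≤ 2n` symmetrically with `Lⁱ⁻ⁿ ∘ θ = id` on
`Hⁱ(X)` (`comp_ofLinearMap_of_lefschetzPow`); for `i > 2n`, `Hⁱ(X) = 0` and the projector is the
zero operator (`isAlgebraicGradedOp_zero`). No hard Lefschetz hypothesis is used beyond what the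
`θ`-form of `B(X, η)` contains.
[cite: Kleiman1968AlgebraicCycles, §1.4 and §2] [cite: Kleiman1994, §4 Thm. 4-1] -/
theorem standardConjectureC_of_standardConjectureB_holds :
    standardConjectureC_of_standardConjectureB (W := W) (n := n) (X := X) (η := η) := by
  intro hX hη hB
  rw [WeilCohomology.standardConjectureC_iff]
  have hL := fun r : ℕ ↦ W.exists_isAlgebraicGradedOp_lefschetzPow hX
    (WeilCohomology.isHyperplaneClass.mem_ratAlgebraicClasses W hX hη) r
  intro i
  by_cases hi : i ≤ n
  · -- `πⁱ = θ ∘ Lⁿ⁻ⁱ`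
    obtain ⟨θ, ⟨-, hθ, -⟩, halg⟩ := hB i (n - i) (i + 2 * (n - i)) (by omega) rfl
    obtain ⟨T, hT, hT₀, hTalg⟩ := hL (n - i)
    have halg' := W.isAlgebraicGradedOp_comp_holds hX hX hX halg hTalg
    rwa [PreWeilCohomology.GradedOp.ofLinearMap_comp_of_lefschetzPow η (n - i) hT hT₀ θ rfl, hθ]
      at halg'
  by_cases hi₂ : i ≤ 2 * n
  · -- `πⁱ = Lⁱ⁻ⁿ ∘ θ`
    have h₂ : (2 * n - i) + 2 * (i - n) = i := by omega
    obtain ⟨θ, ⟨-, -, hθ⟩, halg⟩ := hB (2 * n - i) (i - n) i (by omega) h₂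
    obtain ⟨T, hT, hT₀, hTalg⟩ := hL (i - n)
    have halg' := W.isAlgebraicGradedOp_comp_holds hX hX hX hTalg halg
    rwa [PreWeilCohomology.GradedOp.comp_ofLinearMap_of_lefschetzPow η (i - n) hT hT₀ θ h₂, hθ]
      at halg'
  · -- `Hⁱ(X) = 0`
    haveI := W.subsingleton_obj hX (i := i) (by omega)
    change W.IsAlgebraicGradedOp n n _
    rw [PreWeilCohomology.GradedOp.ofLinearMap_eq_zero_of_subsingleton]
    exact W.isAlgebraicGradedOp_zero n n

end Discharge

end Literature.AlgebraicGeometry.Motives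

end
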